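import Literature.NumberTheory.Automorphic.LocalRingUnitModulusProduct        -- ★ `unitModulusChar_localRing_eq_prod` (`‖u‖ = Π_w |u_w|_w`), ★ `normAbs`, ★ `LocalRing`
import Literature.NumberTheory.Automorphic.LocalFieldHaarBalls                 -- ★ `LocalFieldHaar.continuous_normAbs`
import Literature.NumberTheory.Automorphic.AddCharConductorExponent            -- ★ `normAbs_le_normAbs_iff_valued` (`|x|_w ≤ |y|_w ↔ v x ≤ v y`)
import Literature.NumberTheory.Automorphic.CMBorelAdmissibleTorusRay           -- ★ torus ray `exists_torus_coe_localNonsplitEquiv_eq_diagonal`, ★ `unitModulusChar_lt_one_of_forall_v_lt_one`, `PlacesOver.subsingleton_of_smul_eq`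
import Literature.NumberTheory.Automorphic.HeisenbergChartAtNonsplitPlace      -- ★ `HeisRing.heisZ` ∕ `skewPart` ∕ `fixedPart` ∕ `map_smulFixed_eq` (closure), ★ `valued_conjLocal_apply_of_smul_eq`, ★ `conjLocal_apply_eq_of_smul_eq`
import Literature.NumberTheory.Automorphic.UnitaryGroupRegularTwistModulus      -- ★ `exists_conjLocal_skew_unit` (skew unit `δ`); brings ★ `HeisRing.distribHaarChar_map_eq` (`‖σ x‖ = ‖x‖`)
import HarnessLib

/-!
# F0 · P3c · line LH6 «StCharTS» — «LOCAL-RING NORM DICTIONARY AT A NON-SPLIT PLACE★»: the hypotheses of the generic annulus-slice bricks (★ B2∕B3 of the road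
# «KEYS3-ANALYTIC») DISCHARGED at `R = ∏_{w ∣ v} L_w`, `σ = c ⊗ 1`, `v` non-split, for the concrete norm `nrm b = Π_{w ∣ v} |b_w|_w` [WeilBNT1967 I §2; Rogawski1990 §12.2]

Cell `pub/hodgecm-mathlib`, crux H413 = `stmt-HodgeConjecture-24833` (lane `--supports … --as helper`), route HCCMUnconditional; seat LH6-p04 (g10), twin of the
ROAD «KEYS3-ANALYTIC» holder F0P2-p06 (g21) (LEAD F0P3a-plan T15-03 (b)); the «CM DICTIONARY» half of brick B6b of MEMO `F0/P2/F0P2-p06/g21/MEMO-KEYS3-analytic-road.v3`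
(§4 B6, §5 (r1)), taken by DEFAULT §0 2026-09-03T00:16Z.  THEOREMS ONLY (0 def ∕ 0 instance ∕ 0 notation ∕ 0 sorry); ★-only imports.

WHAT.  `L` CM, `v` a finite place of `L⁺`, `w ∣ v`; `R = LocalRing L v = ∏_{w′ ∣ v} L_{w′}`, `σ = conjLocal` (`c ⊗ 1`).  The norm of record is the PRODUCT OF THE NORMALISED ABSOLUTE
VALUES, written inline everywhere: `nrm b := ∏ w′, normAbs (L_{w′}) (b w′)` (so that ★ `unitModulusChar_localRing_eq_prod` is `‖u‖ = nrm u` on the nose).  At a NON-SPLIT `v` (`hw : c • w = w`,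
one place above `v`, ★ `PlacesOver.subsingleton_of_smul_eq`) this file proves, in the binder spellings of ★ B3 `F0P3cStCharTSHeisenbergAnnulusSlice.integral_annulus_heisZ_eq_zero_of_eigen_unit`
and ★ B2 `F0P3cStCharTSInvolutionRingPolarSlice.skewLineIntegral_eq_zero_of_eigen_unit`:
* §1 the norm: `prod_normAbs_eq_normAbs_apply` (one factor), **`prod_normAbs_units_mul`** (`hmul : nrm (u b) = ‖u‖_R · nrm b`, every `v`), `prod_normAbs_one` (`hone`),
  **`prod_normAbs_conjLocal`** (`hnσ`, ★ `valued_conjLocal_apply_of_smul_eq`), `continuous_prod_normAbs` ∕ `measurable_prod_normAbs` (`hnm`), `prod_normAbs_eq_zero_iff` (`nrm b = 0 ↔ b = 0`),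
  `isUnit_iff_ne_zero_localRing` (`R` is one local field; a skew unit `δ` is ★ `exists_conjLocal_skew_unit`);
* §2 units: **`isUnit_one_add_coe_skewPart`** (`hη : 1 + η ∈ Rˣ` for skew `η` — `1 + η = 0` would force `σ(−1) = 1`, i.e. `2 = 0`) and the modulus∕valuation dictionary
  `unitModulusChar_lt_one_iff` ∕ `one_lt_unitModulusChar_iff` (`‖u‖ < 1 ↔ |u_w|_w < 1`, `1 < ‖u‖ ↔ 1 < |u_w|_w` — the `hQ` binder of ★ B3 read on the valuation; ★
  `unitModulusChar_lt_one_of_forall_v_lt_one`, ★ `v_units_apply_lt_one_of_unitModulusChar_lt_one`).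
FILE 2 (`F0P3cStCharTSLocalRingNormCompactness`, split at the 400-line lint) adds the null sets (`μ {0} = 0` for every Haar `μ`; `hposR`, `hunit`, `hunitp`) and the compactness of the norm
balls and of the Heisenberg chart annulus (`hcptR`, `hcpt`).
WHY: with these, B6b's docking of ★ B3 (slice = 0) ∘ ★ B4 (far-out cell function) ∘ ★ B5 (annulus formula) at the CM place is `exact`s — the last analytic input of RUNG 0's `hKeysRed3` in house
[Keys1984 §7 Thm. (1); Rogawski1990 §12.2 (3)].  No case split by ramification, no `‖2‖`, no residue field in any statement.
HONEST LABEL: HC_CM is proved only modulo the 7 printed citations (2 remaining named inputs: hLiu418 = `stmt-HodgeConjecture-24832`, h413 = `stmt-HodgeConjecture-24833`) until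
rung 0 closes; count-neutral dictionary (no node closes here).

## References
* [WeilBNT1967] A. Weil, *Basic Number Theory* (1967), Ch. I §2 (the module of a local field and of finite products), Ch. II §5.
* [Rogawski1990] J. D. Rogawski, *Automorphic Representations of Unitary Groups in Three Variables*, Ann. of Math. Stud. 123 (1990), §1.9 p. 8, §12.2 p. 173 (`‖·‖_E`).
* [Keys1984] D. Keys, *Principal series representations of special unitary groups over local fields*, Compositio Math. 51 (1984), §7 Thm. (1).
* [TateThesis1967] J. Tate, *Fourier analysis in number fields and Hecke's zeta-functions*, in Cassels–Fröhlich (1967), §2.2 Lemma 2.2.5.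
-/

set_option autoImplicit false
-- the mandated namespace has the single-problem summit's repeated segment (`HodgeConjecture.HodgeConjecture`)
set_option linter.dupNamespace false

noncomputable section

open NumberField IsDedekindDomain MeasureTheory Topology Filter
open scoped NNReal ENNReal Pointwise
open Literature.NumberTheory.Automorphic Literature.NumberTheory.Automorphic.UnitaryGroup
open Literature.NumberTheory.GaloisRepresentations Literature.NumberTheory.GaloisRepresentations.IsNonarchimedeanLocalField

namespace Summit.HodgeConjecture.HodgeConjecture.Cruxes.H413.F0P3cStCharTSLocalRingNormDictionary

variable (L : Type) [Field L] [NumberField L] [IsCMField L] (v : HeightOneSpectrum (𝓞 ↥(maximalRealSubfield L)))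
  (w : PlacesOver L v) (hw : IsCMField.complexConj L • w.1 = w.1)

/-! ## §1 The norm `nrm b = Π_{w′ ∣ v} |b_{w′}|_{w′}` -/

include hw in
/-- **One place above `v`**: `Π_{w′ ∣ v} |b_{w′}|_{w′} = |b_w|_w` at a non-split `v` (★ `PlacesOver.subsingleton_of_smul_eq`). [cite: Rogawski1990, §1.9 p. 8] -/
theorem prod_normAbs_eq_normAbs_apply (b : LocalRing L v) :
    (∏ w' : PlacesOver L v, normAbs (w'.1.adicCompletion L) (b w')) = normAbs (w.1.adicCompletion L) (b w) := by
  haveI : Subsingleton (PlacesOver L v) :=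
    PlacesOver.subsingleton_of_smul_eq (IsCMField.complexConj L) (IsCMField.complexConj_ne_one L) w hw
  exact Fintype.prod_subsingleton _ w

omit [IsCMField L] in
/-- **`hmul`: `nrm (u b) = ‖u‖_R · nrm b`** for a unit `u` (every `v`): the norm is multiplicative factor by factor and `‖u‖_R = Π_w |u_w|_w` (★ `unitModulusChar_localRing_eq_prod`,
★ `unitModulusChar = distribHaarChar`). [cite: WeilBNT1967, Ch. I §2] [cite: TateThesis1967, §2.2 Lemma 2.2.5] -/
theorem prod_normAbs_units_mul (u : (LocalRing L v)ˣ) (b : LocalRing L v) :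
    (∏ w' : PlacesOver L v, normAbs (w'.1.adicCompletion L) (((u : LocalRing L v) * b) w')) =
      distribHaarChar (LocalRing L v) u * ∏ w' : PlacesOver L v, normAbs (w'.1.adicCompletion L) (b w') := by
  have hu : distribHaarChar (LocalRing L v) u = ∏ w' : PlacesOver L v, normAbs (w'.1.adicCompletion L) ((u : LocalRing L v) w') :=
    unitModulusChar_localRing_eq_prod L v u
  rw [hu, ← Finset.prod_mul_distrib]
  exact Finset.prod_congr rfl fun w' _ => by rw [Pi.mul_apply, map_mul]

omit [IsCMField L] in
/-- `hone`: `nrm 1 = 1`. [cite: WeilBNT1967, Ch. I §2] -/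
theorem prod_normAbs_one : (∏ w' : PlacesOver L v, normAbs (w'.1.adicCompletion L) ((1 : LocalRing L v) w')) = 1 :=
  Finset.prod_eq_one fun w' _ => by rw [Pi.one_apply, map_one]

include hw in
/-- **`hnσ`: `nrm (σ b) = nrm b`** at a non-split place (`(σ b)_w = σ_w b_w` and `σ_w` is an isometry, ★ `valued_conjLocal_apply_of_smul_eq`). [cite: Rogawski1990, §1.9 p. 8] -/
theorem prod_normAbs_conjLocal (b : LocalRing L v) :
    (∏ w' : PlacesOver L v, normAbs (w'.1.adicCompletion L) (conjLocal L (IsCMField.complexConj L) v b w')) =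
      ∏ w' : PlacesOver L v, normAbs (w'.1.adicCompletion L) (b w') := by
  haveI : Subsingleton (PlacesOver L v) :=
    PlacesOver.subsingleton_of_smul_eq (IsCMField.complexConj L) (IsCMField.complexConj_ne_one L) w hw
  rw [Fintype.prod_subsingleton _ w, Fintype.prod_subsingleton _ w]
  have hv := valued_conjLocal_apply_of_smul_eq L v w hw b
  exact le_antisymm ((normAbs_le_normAbs_iff_valued w.1 _ _).2 hv.le) ((normAbs_le_normAbs_iff_valued w.1 _ _).2 hv.ge)

omit [IsCMField L] in
/-- `nrm` is continuous (each `|·|_{w′}` is, ★ `LocalFieldHaar.continuous_normAbs`). [cite: WeilBNT1967, Ch. I §2] -/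
theorem continuous_prod_normAbs :
    Continuous fun b : LocalRing L v => ∏ w' : PlacesOver L v, normAbs (w'.1.adicCompletion L) (b w') :=
  continuous_finsetProd _ fun w' _ => LocalFieldHaar.continuous_normAbs.comp (continuous_apply w')

omit [IsCMField L] in
/-- `hnm`: `nrm` is measurable. [cite: WeilBNT1967, Ch. I §2] -/
theorem measurable_prod_normAbs [MeasurableSpace (LocalRing L v)] [BorelSpace (LocalRing L v)] :
    Measurable fun b : LocalRing L v => ∏ w' : PlacesOver L v, normAbs (w'.1.adicCompletion L) (b w') :=
  (continuous_prod_normAbs L v).measurable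

include hw in
/-- **`nrm b = 0 ↔ b = 0`** at a non-split place (one factor; `|x|_w = 0 ↔ x = 0`). [cite: WeilBNT1967, Ch. I §2] -/
theorem prod_normAbs_eq_zero_iff (b : LocalRing L v) :
    (∏ w' : PlacesOver L v, normAbs (w'.1.adicCompletion L) (b w')) = 0 ↔ b = 0 := by
  haveI : Subsingleton (PlacesOver L v) :=
    PlacesOver.subsingleton_of_smul_eq (IsCMField.complexConj L) (IsCMField.complexConj_ne_one L) w hw
  rw [Fintype.prod_subsingleton _ w, map_eq_zero]
  constructor
  · intro h
    funext w'
    obtain rfl : w' = w := Subsingleton.elim w' w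
    exact h
  · intro h
    rw [h, Pi.zero_apply]

include hw in
/-- **Units at a non-split place**: `b ∈ Rˣ ↔ b ≠ 0` (`R` is one local field). [cite: Rogawski1990, §1.9 p. 8] -/
theorem isUnit_iff_ne_zero_localRing (b : LocalRing L v) : IsUnit b ↔ b ≠ 0 := by
  haveI : Subsingleton (PlacesOver L v) :=
    PlacesOver.subsingleton_of_smul_eq (IsCMField.complexConj L) (IsCMField.complexConj_ne_one L) w hw
  constructor
  · rintro hb rfl
    exact units_apply_ne_zero L v w hb.unit (by rw [hb.unit_spec, Pi.zero_apply])
  · intro hb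
    have hbw : b w ≠ 0 := fun h0 => hb (funext fun w' => by
      obtain rfl : w' = w := Subsingleton.elim w' w
      rw [h0, Pi.zero_apply])
    exact Pi.isUnit_iff.2 fun w' => by
      obtain rfl : w' = w := Subsingleton.elim w' w
      exact isUnit_iff_ne_zero.2 hbw

/-! ## §2 Units: `1 + R⁻ ⊆ Rˣ` and the modulus∕valuation dictionary -/

include hw in
/-- **`hη`: `1 + η` is a unit for every skew `η`** (`σ η = −η`): at a non-split place `1 + η_w = 0` would give `σ_w(−1) = 1`, i.e. `2 = 0` in `L_w`. [cite: Rogawski1990, §1.9 p. 8] -/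
theorem isUnit_one_add_coe_skewPart (η : ↥(HeisRing.skewPart (conjLocal L (IsCMField.complexConj L) v))) :
    IsUnit (1 + (η : LocalRing L v)) := by
  rw [isUnit_iff_ne_zero_localRing L v w hw]
  intro h0
  have hη : conjLocal L (IsCMField.complexConj L) v (η : LocalRing L v) = -(η : LocalRing L v) := (HeisRing.mem_skewPart_iff _ _).1 η.2
  -- `σ (1 + η) = 1 - η = 0` too, so `2 = (1 + η) + (1 - η) = 0` in `R`, absurd at the place `w`
  have h1 : (1 : LocalRing L v) - (η : LocalRing L v) = 0 := by
    have := congrArg (conjLocal L (IsCMField.complexConj L) v) h0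
    rwa [map_add, map_one, hη, map_zero, ← sub_eq_add_neg] at this
  have h2 : (2 : LocalRing L v) = 0 := by linear_combination h0 + h1
  have h2w := congr_fun h2 w
  rw [Pi.zero_apply] at h2w
  exact two_ne_zero h2w

include hw in
/-- **`‖u‖ < 1 ↔ |u_w|_w < 1`** at a non-split place (★ `unitModulusChar_lt_one_of_forall_v_lt_one`, ★ `unitModulusChar_eq_one_of_forall_v_eq_one`, trichotomy). [cite: Rogawski1990, §12.2 p. 173] -/
theorem unitModulusChar_lt_one_iff (u : (LocalRing L v)ˣ) :
    unitModulusChar (LocalRing L v) u < 1 ↔ Valued.v ((u : LocalRing L v) w) < 1 := by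
  haveI : Subsingleton (PlacesOver L v) :=
    PlacesOver.subsingleton_of_smul_eq (IsCMField.complexConj L) (IsCMField.complexConj_ne_one L) w hw
  exact ⟨v_units_apply_lt_one_of_unitModulusChar_lt_one L v w hw u,
    fun h => unitModulusChar_lt_one_of_forall_v_lt_one L v u fun w' => by rw [Subsingleton.elim w' w]; exact h⟩

include hw in
/-- **`1 < ‖u‖ ↔ 1 < |u_w|_w`** at a non-split place (the `hQ : 1 < ‖α‖_R` binder of ★ B3, read on the valuation). [cite: Rogawski1990, §12.2 p. 173] -/
theorem one_lt_unitModulusChar_iff (u : (LocalRing L v)ˣ) :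
    1 < unitModulusChar (LocalRing L v) u ↔ 1 < Valued.v ((u : LocalRing L v) w) := by
  -- `‖u‖ · ‖u⁻¹‖ = 1` and `|u_w| · |u⁻¹_w| = 1`: `1 < a ↔ a⁻¹ < 1` on both sides, and §3 for `u⁻¹`
  have hm : unitModulusChar (LocalRing L v) u⁻¹ = (unitModulusChar (LocalRing L v) u)⁻¹ := map_inv _ _
  have hv : Valued.v (((u⁻¹ : (LocalRing L v)ˣ) : LocalRing L v) w) = (Valued.v ((u : LocalRing L v) w))⁻¹ := by
    have hprod : Valued.v (((u⁻¹ : (LocalRing L v)ˣ) : LocalRing L v) w) * Valued.v ((u : LocalRing L v) w) = 1 := by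
      rw [← map_mul, ← Pi.mul_apply, ← Units.val_mul, inv_mul_cancel, Units.val_one, Pi.one_apply, map_one]
    exact eq_inv_of_mul_eq_one_left hprod
  have h0m : 0 < unitModulusChar (LocalRing L v) u := by unfold unitModulusChar; exact distribHaarChar_pos
  have h0v : 0 < Valued.v ((u : LocalRing L v) w) := zero_lt_iff.2 fun h0 => units_apply_ne_zero L v w u ((Valuation.zero_iff _).1 h0)
  rw [← inv_lt_one₀ h0m, ← inv_lt_one₀ h0v, ← hm, ← hv]
  exact unitModulusChar_lt_one_iff L v w hw u⁻¹

end Summit.HodgeConjecture.HodgeConjecture.Cruxes.H413.F0P3cStCharTSLocalRingNormDictionary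

end
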